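import Summits.QuantumFields.YangMills.Theorems.FluctuationComparisonRegPrIntLS2BetaCovariantOscillationRegUpClosed
import Summits.QuantumFields.YangMills.Theorems.FluctuationComparisonRegPrIntLS2BetaOscillationProfile
import HarnessLib

/-!
# S2β · (REG-UP)′ PROFILED — «THE LEVEL-k OSCILLATION LETTER IS ONE SCALE POWER»: ✓p840777 `hOSC_regUp_closed` ∘ ✓`oscLetter_le_profile` with the row constant made level-free
# (`Λ_k ≤ Λ̄ := (1+4(d+2))·exp(C·Cα∕(L²−1))` on `θ_k = L^{2k}q ≤ 1`): C₇b's covariant oscillation letter at level `k` with `O_k ≤ o·θ_k`, `o` EXPLICIT and independent of `k` and `K` —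
# the `hOlev` input of w4 g29's (f0) `haA_of_profiles` in the tree's own syntax

Cell `ym3-torus` (YM ladder rung R3 = continuum `SU(2)` Yang–Mills on the three-torus at fixed lattice data — a RUNG: NOT d = 4, NOT infinite volume, NOT a mass gap,
NOT Clay).  Width seat «width 12» `ym3-torus-px12` (gen 27); crux `stmt-QuantumFields-20520`, LINE g18-1 S2β, c₁ column ((O3-a) ratio profile).  `--kind proof --supports stmt-QuantumFields-20520
--as helper`, count-neutral, DEFINITION-FREE (0 `def`, 0 `instance`, 0 `notation`, 0 `sorry`; default heartbeats except ONE decl-local `maxHeartbeats 400000 in` on `hOSC_regUp_profiled`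
(w8 g23 hb-census 04:17Z: 160k ✗ ∕ 180k ✓ — margin cure, statement bytes untouched).  `SU(N)`, towers `F.P K`, `k + 2 ≤ m + K`.

WHAT IS PROVED (sorry-free).  `sum_alpha_le` (`Σ_{j<k} α_j ≤ Cα∕(L²−1)` under `α_j ≤ Cα·L^{2j}·q`, `L^{2k}q ≤ 1`), `rowConst_le_bar` (`Λ_k ≤ Λ̄`), ★★★**`hOSC_regUp_profiled`** — the hOSC text of ✓p840777 with
right-hand side `o·(L^{2k}·q)`, `o = 2·(d·3L)·(2·Cε·m + m·(Λ̄∕L)·((2·67·ℓ∕a)·(2·((d−1)·2L)·Cδ∕(L²−1) + (2Cε+Cδ)∕(L−1))) + Cc + 2·(Λ̄·Cr∕(L²−L)))`.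

HONEST SCOPE.  Arithmetic over landed letters; nothing of Bałaban's renormalisation-group analysis proved; displayed HYPOTHESES: the physical letters of ✓p840777 AND their one-power profiles (`α, δ, ε ≤ C·L^{2i}·q` —
BKG class ∕ line recursion; `r(i+1) ≤ Cr·L^{2i}·q` — C-M ∕ second order; transported size `Λ̄·L^k·‖Xd 0‖ ≤ m`; transported gradient `Λ̄·L^k·(ℓc₀) ≤ Cc·θ_k`); (f0)∕(O3-a) (w4), C-M (px20), GAP♯∘
(`stub_uniformFibreGapOrbit`, registry 3732b7df UNTOUCHED, 0∕5), the five registered stubs, S2β, crux 20520, 19936, 19200, `YM3TorusSU2` — NOT proved; rung R3 — NOT d = 4, NOT infinite volume,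
NOT a mass gap, NOT Clay; the Yang–Mills mass gap is NOT proved.
-/

set_option autoImplicit false

noncomputable section

open scoped Matrix.Norms.L2Operator Topology
open Filter Set Function

namespace Summit.QuantumFields.YangMills.Theorems.FluctuationComparisonRegPrIntLS2BetaCovariantOscillationRegUpProfiled

open Literature.MathematicalPhysics.QuantumFieldTheory.Balaban1983to89
open Literature.MathematicalPhysics.QuantumFieldTheory.Balaban1983to89.HaarExponentialChart
open Literature.MathematicalPhysics.QuantumFieldTheory.Balaban1983to89.HaarExponentialChart.IsChartRep
open Literature.MathematicalPhysics.QuantumFieldTheory.Balaban1983to89.BlockAveraging (Small Idx avgFun loopHol blockAvg blockAvg_avg)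
open Literature.MathematicalPhysics.QuantumFieldTheory.Balaban1983to89.ExpMeanLog (expMeanLogSU deltaSU)
open Literature.MathematicalPhysics.QuantumFieldTheory.Balaban1983to89.Node00
open Literature.MathematicalPhysics.QuantumFieldTheory.Balaban1983to89.T3ContinuumYM3Torus
open Literature.MathematicalPhysics.QuantumFieldTheory.Balaban1983to89.B10Eq47AxialChi (rowProd)
open Summit.QuantumFields.YangMills.BalabanUVNodes.N09ChartReadAveragingSmooth
open Summit.QuantumFields.YangMills.Theorems.FluctuationComparisonRegPrIntLS2BetaChartReadGaugeCovariance (conj_mem_lie)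
open Summit.QuantumFields.YangMills.Theorems.FluctuationComparisonRegPrIntLS2BetaCovariantOscillationRegUpClosed (hOSC_regUp_closed)
open Summit.QuantumFields.YangMills.Theorems.FluctuationComparisonRegPrIntLS2BetaOscillationProfile (sum_pow_two_mul_le oscLetter_le_profile)

variable {N : ℕ} [NeZero N] (F : T3Family)

/-- `Σ_{j<k} α_j ≤ Cα∕(L²−1)` under the one-power profile `α_j ≤ Cα·L^{2j}·q` and `L^{2k}·q ≤ 1` (`1 < L`, `0 ≤ Cα`, `0 ≤ q`). [folklore] -/
theorem sum_alpha_le {L q Cα : ℝ} (hL : 1 < L) (hq : 0 ≤ q) (hCα : 0 ≤ Cα) (k : ℕ) (α : ℕ → ℝ)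
    (hαp : ∀ j, j < k → α j ≤ Cα * L ^ (2 * j) * q) (hθ1 : L ^ (2 * k) * q ≤ 1) :
    ∑ j ∈ Finset.range k, α j ≤ Cα / (L ^ 2 - 1) := by
  have hL21 : 0 < L ^ 2 - 1 := by nlinarith
  have h1 : ∑ j ∈ Finset.range k, α j ≤ ∑ j ∈ Finset.range k, Cα * q * L ^ (2 * j) :=
    Finset.sum_le_sum fun j hj => by rw [Finset.mem_range] at hj; nlinarith [hαp j hj]
  rw [← Finset.mul_sum] at h1
  have h2 := mul_le_mul_of_nonneg_left (sum_pow_two_mul_le hL k) (mul_nonneg hCα hq)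
  have h3 : Cα * q * (L ^ (2 * k) / (L ^ 2 - 1)) = Cα / (L ^ 2 - 1) * (L ^ (2 * k) * q) := by ring
  have h4 : Cα / (L ^ 2 - 1) * (L ^ (2 * k) * q) ≤ Cα / (L ^ 2 - 1) := by
    have : 0 ≤ Cα / (L ^ 2 - 1) := by positivity
    nlinarith
  linarith

/-- `Λ_k ≤ Λ̄`: the row constant at level `k` is below the level-free `(1+4(d+2))·exp(C·Cα∕(L²−1))` under the `α`-profile. [folklore] -/
theorem rowConst_le_bar {K k : ℕ} {q Cα : ℝ} (hq : 0 ≤ q) (hCα : 0 ≤ Cα) (α : ℕ → ℝ)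
    (hαp : ∀ j, j < k → α j ≤ Cα * ((F.P K).L : ℝ) ^ (2 * j) * q) (hθ1 : ((F.P K).L : ℝ) ^ (2 * k) * q ≤ 1) :
    ((1 + 4 * (((F.P K).d + 2 : ℕ) : ℝ)) * Real.exp ((((F.P K).d + 2 : ℕ) : ℝ) * (422 + 1616 * (((F.P K).d + 2 : ℕ) : ℝ)) * ∑ j ∈ Finset.range k, α j)) ≤ ((1 + 4 * (((F.P K).d + 2 : ℕ) : ℝ)) * Real.exp ((((F.P K).d + 2 : ℕ) : ℝ) * (422 + 1616 * (((F.P K).d + 2 : ℕ) : ℝ)) * (Cα / (((F.P K).L : ℝ) ^ 2 - 1)))) := by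
  have hL : (1 : ℝ) < ((F.P K).L : ℝ) := by
    have h := (F.hL).2
    have e : (F.P K).L = F.L := rfl
    rw [e]; exact_mod_cast h
  have hs := sum_alpha_le hL hq hCα k α hαp hθ1
  have hC : (0 : ℝ) ≤ (((F.P K).d + 2 : ℕ) : ℝ) * (422 + 1616 * (((F.P K).d + 2 : ℕ) : ℝ)) := by positivity
  have h1 : (0 : ℝ) ≤ 1 + 4 * (((F.P K).d + 2 : ℕ) : ℝ) := by positivity
  exact mul_le_mul_of_nonneg_left (Real.exp_le_exp.2 (mul_le_mul_of_nonneg_left hs hC)) h1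

set_option maxHeartbeats 400000 in
/-- ★★★ **(REG-UP)′ PROFILED — ONE SCALE POWER**: under the hypotheses of ✓p840777 `hOSC_regUp_closed` and the one-power profiles (`θ_k := L^{2k}·q ≤ 1`):
C₇b's covariant oscillation letter at level `k` with `O_k ≤ o·θ_k`, `o` the EXPLICIT level-free constant of the module docstring. [cite: Balaban1985RegularSpaces, (1.36) p.82; Balaban1985Averaging, Prop. 4 (128)-(135) pp.37-38; Balaban1987RG1, (0.3)-(0.4), (0.11) pp.252-253] -/
theorem hOSC_regUp_profiled {K k : ℕ} (hk2 : k + 2 ≤ F.m + K) (U₀ : GaugeField (F.P K) 0 (SU N)) (Xd : (i : ℕ) → (PBond (F.P K) i → (specialUnitaryLogChart (Fin N)).lie))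
    {α δ ε r : ℕ → ℝ} {ρ a ℓ c₀ q Cα Cδ Cε Cr Cc m : ℝ} (hα0 : ∀ l, 0 ≤ α l) (hα24 : ∀ l, α l ≤ 1 / 24) (hαδ : ∀ l, α l < deltaSU (Fin N))
    (hαU : (∀ l, l < k → ∀ (c : PBond (F.P K) (l + 1)) (idx : Idx (F.P K)), dist1 (loopHol (Averaging.iter (fun i => blockAvg (P := F.P K) (j := i) (expMeanLogSU (n := Fin N))) l U₀) c idx) ≤ α l))
    (hρ0 : 0 < ρ) (hρ : ρ ≤ innerRadius (specialUnitaryLogChart (Fin N))) (hα4 : ∀ l, 4 * α l ≤ ρ)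
    (hδ0 : ∀ l, 0 ≤ δ l) (hδ : ∀ l, l < k → PlaqSmall (δ l) (Averaging.iter (fun i => blockAvg (P := F.P K) (j := i) (expMeanLogSU (n := Fin N))) l U₀))
    (hε0 : ε 0 = 0) (hεnn : ∀ i, 0 ≤ ε i) (hε : ∀ i, i < k → ((F.P K).L : ℝ) * ε i + 2 * α i ≤ ε (i + 1))
    (hwin : ∀ i, i < k → 100 * (((((F.P K).d + 2) * (F.P K).L : ℕ) : ℝ) * (((((F.P K).d - 1 : ℕ) : ℝ) * ((2 * (F.P K).L : ℕ) : ℝ) * δ i) + (((((F.P K).d - 1 : ℕ) : ℝ) * ((2 * (F.P K).L : ℕ) : ℝ) * δ i) + ((((F.P K).L ^ (k - i) : ℕ) : ℝ) * (2 * ε i + δ i))))) ≤ ρ)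
    (ha0 : 0 < a) (ha : 100 * (((((F.P K).d + 2) * (F.P K).L : ℕ) : ℝ) * (Real.exp a - 1)) ≤ ρ)
    (hℓc₀ : 0 ≤ ℓ * c₀)
    (hc₀ : ∀ (μ : Fin (F.P K).d) (b : PBond (F.P K) 0), ‖(((fun b : PBond (F.P K) 0 => (⟨((rowProd U₀ b.src μ ((F.P K).L ^ k) : SU N) : Matrix (Fin N) (Fin N) ℂ) * (((Xd 0) (b.translate (Site.scaleTo k ((0 : Site (F.P K) k).shift μ))) : (specialUnitaryLogChart (Fin N)).lie) : Matrix (Fin N) (Fin N) ℂ) * star ((rowProd U₀ b.src μ ((F.P K).L ^ k) : SU N) : Matrix (Fin N) (Fin N) ℂ), conj_mem_lie (rowProd U₀ b.src μ ((F.P K).L ^ k)) ((Xd 0) (b.translate (Site.scaleTo k ((0 : Site (F.P K) k).shift μ))))⟩ : (specialUnitaryLogChart (Fin N)).lie)) b : (specialUnitaryLogChart (Fin N)).lie) : Matrix (Fin N) (Fin N) ℂ) - (((Xd 0) b : (specialUnitaryLogChart (Fin N)).lie) : Matrix (Fin N) (Fin N) ℂ)‖ ≤ ℓ * c₀)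
    (hr0 : ∀ l, 0 ≤ r l)
    (hr : ∀ i, i < k → ∀ c' : PBond (F.P K) (i + 1),
      ‖((Xd (i + 1) c' : (specialUnitaryLogChart (Fin N)).lie) : Matrix (Fin N) (Fin N) ℂ) - (((fderiv ℝ (fun (B : PBond (F.P K) i → (specialUnitaryLogChart (Fin N)).lie) (c' : PBond (F.P K) (i + 1)) => (isChartRep_specialUnitaryGroup (n := Fin N)).logChart (avgFun (expMeanLogSU (n := Fin N)) (fun c => (isChartRep_specialUnitaryGroup (n := Fin N)).expChart (B c) * (Averaging.iter (fun i => blockAvg (P := F.P K) (j := i) (expMeanLogSU (n := Fin N))) i U₀) c) c' * (avgFun (expMeanLogSU (n := Fin N)) ((Averaging.iter (fun i => blockAvg (P := F.P K) (j := i) (expMeanLogSU (n := Fin N))) i U₀)) c')⁻¹)) 0) (Xd i) c' : (specialUnitaryLogChart (Fin N)).lie) : Matrix (Fin N) (Fin N) ℂ)‖ ≤ r (i + 1))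
    (hq : 0 ≤ q) (hCα : 0 ≤ Cα) (hCδ : 0 ≤ Cδ) (hCε : 0 ≤ Cε) (hCr : 0 ≤ Cr) (hθ1 : ((F.P K).L : ℝ) ^ (2 * k) * q ≤ 1)
    (hαp : ∀ j, j < k → α j ≤ Cα * ((F.P K).L : ℝ) ^ (2 * j) * q)
    (hδp : ∀ i, i ≤ k → δ i ≤ Cδ * ((F.P K).L : ℝ) ^ (2 * i) * q) (hεp : ∀ i, i ≤ k → ε i ≤ Cε * ((F.P K).L : ℝ) ^ (2 * i) * q)
    (hrp : ∀ i, i < k → r (i + 1) ≤ Cr * ((F.P K).L : ℝ) ^ (2 * i) * q)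
    (hM : ((1 + 4 * (((F.P K).d + 2 : ℕ) : ℝ)) * Real.exp ((((F.P K).d + 2 : ℕ) : ℝ) * (422 + 1616 * (((F.P K).d + 2 : ℕ) : ℝ)) * (Cα / (((F.P K).L : ℝ) ^ 2 - 1)))) * ((F.P K).L : ℝ) ^ k * ‖Xd 0‖ ≤ m) (hcc : ((1 + 4 * (((F.P K).d + 2 : ℕ) : ℝ)) * Real.exp ((((F.P K).d + 2 : ℕ) : ℝ) * (422 + 1616 * (((F.P K).d + 2 : ℕ) : ℝ)) * (Cα / (((F.P K).L : ℝ) ^ 2 - 1)))) * ((F.P K).L : ℝ) ^ k * (ℓ * c₀) ≤ Cc * (((F.P K).L : ℝ) ^ (2 * k) * q))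
    {μ ν : Fin (F.P K).d} (y' : Site (F.P K) (k + 1)) (b b' : PBond (F.P K) k)
    (hb : blockOf b.src = y' ∨ blockOf b.src = y'.shift μ ∨ blockOf b.src = y'.shift ν ∨ blockOf b.src = (y'.shift μ).shift ν)
    (hb' : blockOf b'.src = y' ∨ blockOf b'.src = y'.shift μ ∨ blockOf b'.src = y'.shift ν ∨ blockOf b'.src = (y'.shift μ).shift ν)
    (hdir : b.dir = b'.dir) :
    ‖(((T4AxialGaugeSmallField.axialGauge (Averaging.iter (fun i => blockAvg (P := F.P K) (j := i) (expMeanLogSU (n := Fin N))) k U₀) (fun κ : Fin (F.P K).d => (((emb y' κ).val : ℕ) : ℤ) - ((((F.P K).L - 1) / 2 : ℕ) : ℤ)) (fun κ : Fin (F.P K).d => (((emb y' κ).val : ℕ) : ℤ) + (((if κ = μ then ((F.P K).L : ℤ) else 0) + (if κ = ν then ((F.P K).L : ℤ) else 0)) + ((((F.P K).L - 1) / 2 : ℕ) : ℤ)) + 1) b.src : SU N)) : Matrix (Fin N) (Fin N) ℂ) * ((Xd k b : (specialUnitaryLogChart (Fin N)).lie) : Matrix (Fin N) (Fin N) ℂ)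 * star (((T4AxialGaugeSmallField.axialGauge (Averaging.iter (fun i => blockAvg (P := F.P K) (j := i) (expMeanLogSU (n := Fin N))) k U₀) (fun κ : Fin (F.P K).d => (((emb y' κ).val : ℕ) : ℤ) - ((((F.P K).L - 1) / 2 : ℕ) : ℤ)) (fun κ : Fin (F.P K).d => (((emb y' κ).val : ℕ) : ℤ) + (((if κ = μ then ((F.P K).L : ℤ) else 0) + (if κ = ν then ((F.P K).L : ℤ) else 0)) + ((((F.P K).L - 1) / 2 : ℕ) : ℤ)) + 1) b.src : SU N)) : Matrix (Fin N) (Fin N) ℂ) -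
      (((T4AxialGaugeSmallField.axialGauge (Averaging.iter (fun i => blockAvg (P := F.P K) (j := i) (expMeanLogSU (n := Fin N))) k U₀) (fun κ : Fin (F.P K).d => (((emb y' κ).val : ℕ) : ℤ) - ((((F.P K).L - 1) / 2 : ℕ) : ℤ)) (fun κ : Fin (F.P K).d => (((emb y' κ).val : ℕ) : ℤ) + (((if κ = μ then ((F.P K).L : ℤ) else 0) + (if κ = ν then ((F.P K).L : ℤ) else 0)) + ((((F.P K).L - 1) / 2 : ℕ) : ℤ)) + 1) b'.src : SU N)) : Matrix (Fin N) (Fin N) ℂ) * ((Xd k b' : (specialUnitaryLogChart (Fin N)).lie) : Matrix (Fin N) (Fin N) ℂ) * star (((T4AxialGaugeSmallField.axialGauge (Averaging.iter (fun i => blockAvg (P := F.P K) (j := i) (expMeanLogSU (n := Fin N))) k U₀) (fun κ : Fin (F.P K).d => (((emb y' κ).val : ℕ) : ℤ) - ((((F.P K).L - 1) / 2 : ℕ) : ℤ)) (fun κ : Fin (F.P K).d => (((emb y' κ).val : ℕ) : ℤ) + (((if κ = μ then ((F.P K).L : ℤ) else 0) + (if κ = ν then ((F.P K).L : ℤ)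 else 0)) + ((((F.P K).L - 1) / 2 : ℕ) : ℤ)) + 1) b'.src : SU N)) : Matrix (Fin N) (Fin N) ℂ)‖ ≤
      (2 * ((((F.P K).d : ℕ) : ℝ) * ((3 * (F.P K).L : ℕ) : ℝ)) * (2 * Cε * m + m * (((1 + 4 * (((F.P K).d + 2 : ℕ) : ℝ)) * Real.exp ((((F.P K).d + 2 : ℕ) : ℝ) * (422 + 1616 * (((F.P K).d + 2 : ℕ) : ℝ)) * (Cα / (((F.P K).L : ℝ) ^ 2 - 1)))) / ((F.P K).L : ℝ)) * ((2 * 67 * ((((F.P K).d + 2) * (F.P K).L : ℕ) : ℝ) / a) * (2 * ((((F.P K).d - 1 : ℕ) : ℝ) * ((2 * (F.P K).L : ℕ) : ℝ)) * Cδ / (((F.P K).L : ℝ) ^ 2 - 1) + (2 * Cε + Cδ) / (((F.P K).L : ℝ) - 1))) + Cc + 2 * (((1 + 4 * (((F.P K).d + 2 : ℕ) : ℝ)) * Real.exp ((((F.P K).d + 2 : ℕ) : ℝ) * (422 + 1616 * (((F.P K).d + 2 : ℕ) : ℝ)) * (Cα / (((F.P K).L : ℝ) ^ 2 - 1)))) *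 Cr / (((F.P K).L : ℝ) ^ 2 - ((F.P K).L : ℝ))))) * (((F.P K).L : ℝ) ^ (2 * k) * q) := by
  have hL : (1 : ℝ) < ((F.P K).L : ℝ) := by
    have h := (F.hL).2
    have e : (F.P K).L = F.L := rfl
    rw [e]; exact_mod_cast h
  have hknot := hOSC_regUp_closed F hk2 U₀ Xd hα0 hα24 hαδ hαU hρ0 hρ hα4 hδ0 hδ hε0 hεnn hε hwin ha0 ha hℓc₀ hc₀ hr0 hr y' b b' hb hb' hdir
  simp only [Nat.cast_pow] at hknot
  -- the row constant at level `k` and the level-free one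
  have hΛbar := rowConst_le_bar F (K := K) (k := k) hq hCα α hαp hθ1
  have hΛ0 : (0 : ℝ) ≤ ((1 + 4 * (((F.P K).d + 2 : ℕ) : ℝ)) * Real.exp ((((F.P K).d + 2 : ℕ) : ℝ) * (422 + 1616 * (((F.P K).d + 2 : ℕ) : ℝ)) * ∑ j ∈ Finset.range k, α j)) := by positivity
  have hLk : (0 : ℝ) ≤ ((F.P K).L : ℝ) ^ k := by positivity
  have hM' : ((1 + 4 * (((F.P K).d + 2 : ℕ) : ℝ)) * Real.exp ((((F.P K).d + 2 : ℕ) : ℝ) * (422 + 1616 * (((F.P K).d + 2 : ℕ) : ℝ)) * ∑ j ∈ Finset.range k, α j)) * ((F.P K).L : ℝ) ^ k * ‖Xd 0‖ ≤ m :=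
    (mul_le_mul_of_nonneg_right (mul_le_mul_of_nonneg_right hΛbar hLk) (norm_nonneg _)).trans hM
  have hc' : ((1 + 4 * (((F.P K).d + 2 : ℕ) : ℝ)) * Real.exp ((((F.P K).d + 2 : ℕ) : ℝ) * (422 + 1616 * (((F.P K).d + 2 : ℕ) : ℝ)) * ∑ j ∈ Finset.range k, α j)) * ((F.P K).L : ℝ) ^ k * (ℓ * c₀) ≤ Cc * (((F.P K).L : ℝ) ^ (2 * k) * q) :=
    (mul_le_mul_of_nonneg_right (mul_le_mul_of_nonneg_right hΛbar hLk) hℓc₀).trans hcc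
  have hO := oscLetter_le_profile (L := ((F.P K).L : ℝ)) (q := q) (a := a) (ℓℓ := ((((F.P K).d + 2) * (F.P K).L : ℕ) : ℝ)) (D := ((((F.P K).d : ℕ) : ℝ) * ((3 * (F.P K).L : ℕ) : ℝ))) (Dm := ((((F.P K).d - 1 : ℕ) : ℝ) * ((2 * (F.P K).L : ℕ) : ℝ))) (Λ := ((1 + 4 * (((F.P K).d + 2 : ℕ) : ℝ)) * Real.exp ((((F.P K).d + 2 : ℕ) : ℝ) * (422 + 1616 * (((F.P K).d + 2 : ℕ) : ℝ)) * ∑ j ∈ Finset.range k, α j))) (M₀ := ‖Xd 0‖) (m := m) (c := ℓ * c₀)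
    (Cδ := Cδ) (Cε := Cε) (Cr := Cr) (Cc := Cc) hL hq ha0 (by positivity) (by positivity) (by positivity) hΛ0 (norm_nonneg _) hCδ hCε hCr k δ ε r
    (fun i hi => ⟨hδ0 i, hδp i hi⟩) (fun i hi => ⟨hεnn i, hεp i hi⟩) (fun i hi => ⟨hr0 (i + 1), hrp i hi⟩) hM' hc'
  refine hknot.trans (hO.trans ?_)
  -- monotonicity of `o` in the row constant
  have hθ0 : (0 : ℝ) ≤ ((F.P K).L : ℝ) ^ (2 * k) * q := by positivity
  have hm0 : 0 ≤ m := le_trans (by positivity) hM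
  have hX : (0 : ℝ) ≤ (2 * 67 * ((((F.P K).d + 2) * (F.P K).L : ℕ) : ℝ) / a) * (2 * ((((F.P K).d - 1 : ℕ) : ℝ) * ((2 * (F.P K).L : ℕ) : ℝ)) * Cδ / (((F.P K).L : ℝ) ^ 2 - 1) + (2 * Cε + Cδ) / (((F.P K).L : ℝ) - 1)) := by
    have : (0 : ℝ) < ((F.P K).L : ℝ) ^ 2 - 1 := by nlinarith
    have : (0 : ℝ) < ((F.P K).L : ℝ) - 1 := by linarith
    positivity
  have hLL0 : (0 : ℝ) < ((F.P K).L : ℝ) := by linarith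
  have hL2L : (0 : ℝ) < ((F.P K).L : ℝ) ^ 2 - ((F.P K).L : ℝ) := by nlinarith
  have hD0 : (0 : ℝ) ≤ 2 * ((((F.P K).d : ℕ) : ℝ) * ((3 * (F.P K).L : ℕ) : ℝ)) := by positivity
  refine mul_le_mul_of_nonneg_right ?_ hθ0
  refine mul_le_mul_of_nonneg_left ?_ hD0
  have t1 : m * (((1 + 4 * (((F.P K).d + 2 : ℕ) : ℝ)) * Real.exp ((((F.P K).d + 2 : ℕ) : ℝ) * (422 + 1616 * (((F.P K).d + 2 : ℕ) : ℝ)) * ∑ j ∈ Finset.range k, α j)) / ((F.P K).L : ℝ)) * ((2 * 67 * ((((F.P K).d + 2) * (F.P K).L : ℕ) : ℝ) / a) * (2 * ((((F.P K).d - 1 : ℕ) : ℝ) * ((2 * (F.P K).L : ℕ) : ℝ)) * Cδ / (((F.P K).L : ℝ) ^ 2 - 1) + (2 * Cε + Cδ) / (((F.P K).L : ℝ) - 1))) ≤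
      m * (((1 + 4 * (((F.P K).d + 2 : ℕ) : ℝ)) * Real.exp ((((F.P K).d + 2 : ℕ) : ℝ) * (422 + 1616 * (((F.P K).d + 2 : ℕ) : ℝ)) * (Cα / (((F.P K).L : ℝ) ^ 2 - 1)))) / ((F.P K).L : ℝ)) * ((2 * 67 * ((((F.P K).d + 2) * (F.P K).L : ℕ) : ℝ) / a) * (2 * ((((F.P K).d - 1 : ℕ) : ℝ) * ((2 * (F.P K).L : ℕ) : ℝ)) * Cδ / (((F.P K).L : ℝ) ^ 2 - 1) + (2 * Cε + Cδ) / (((F.P K).L : ℝ) - 1))) :=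
    mul_le_mul_of_nonneg_right (mul_le_mul_of_nonneg_left (div_le_div_of_nonneg_right hΛbar hLL0.le) hm0) hX
  have t2 : ((1 + 4 * (((F.P K).d + 2 : ℕ) : ℝ)) * Real.exp ((((F.P K).d + 2 : ℕ) : ℝ) * (422 + 1616 * (((F.P K).d + 2 : ℕ) : ℝ)) * ∑ j ∈ Finset.range k, α j)) * Cr / (((F.P K).L : ℝ) ^ 2 - ((F.P K).L : ℝ)) ≤ ((1 + 4 * (((F.P K).d + 2 : ℕ) : ℝ)) * Real.exp ((((F.P K).d + 2 : ℕ) : ℝ) * (422 + 1616 * (((F.P K).d + 2 : ℕ) : ℝ)) * (Cα / (((F.P K).L : ℝ) ^ 2 - 1)))) * Cr / (((F.P K).L : ℝ) ^ 2 - ((F.P K).L : ℝ)) :=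
    div_le_div_of_nonneg_right (mul_le_mul_of_nonneg_right hΛbar hCr) hL2L.le
  linarith

end Summit.QuantumFields.YangMills.Theorems.FluctuationComparisonRegPrIntLS2BetaCovariantOscillationRegUpProfiled

end
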